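import Literature.Analysis.FluidPDE.PeriodicLerayGalerkin
import Mathlib.Analysis.InnerProductSpace.Calculus
import HarnessLib

/-!
# [BT1] Lemma 2.6, the Galerkin approximants: the weak formulation on the Galerkin space and the
  equicontinuity of its pairings

Analysis/FluidPDE proof file (theorems only; no definitions, no named facts) in the DAG below the
named fact `Literature.Analysis.FluidPDE.bradshawTsai2017_thm_2_4_mollified`
(`PeriodicLerayExistence.lean`; Bradshaw–Tsai, Ann. Henri Poincaré 18 (2017) = arXiv:1510.07504
[BT1], Lemma 2.6 and the proof of Thm 2.4). [BT1] §2: "the weak formulation …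
`d/ds (U, f) = −(∇U, ∇f) + (U + y·∇U, f) − ((η_ε*U)·∇U, f) − (W·∇U + U·∇W, f) − ⟨ℛ(W), f⟩`";
for the Galerkin approximants `U_k = Σᵢ b_{ki} aᵢ` of Lemma 2.6 this holds **for every `f` in
the Galerkin space `span{a₁, …, a_k}`** ("multiplying the `j`-th equation by … and summing"),
which is the form in which the system of ODEs enters the passage to the limit `k → ∞` (Temam,
*Navier–Stokes equations*, Ch. III, §3, (3.43)–(3.46)). This file proves, for a `C¹` solution
`b` of the Galerkin system over an `L²`-orthonormal family of test fields `a` and every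
coefficient vector `c` (`g = Σⱼ cⱼ aⱼ`):

* `galerkinForm_galerkinSum_right` — linearity of the right-hand side in the test slot;
* `inner_galerkinRHS_eq_galerkinForm_pair` — `⟪F(s, β), c⟫ = RHS(s; Σ βᵢaᵢ, Σ cⱼaⱼ)`;
* `hasDerivAt_pairing_galerkinSum` — **`d/ds (U_k(s), g) = RHS(s; U_k(s), g)`**;
* `continuous_galerkinForm_along` — continuity of `s ↦ RHS(s; U_k(s), g)` along the solution;
* `integral_galerkinForm_eq_pairing_sub` — the integrated form
  `(U_k(t), g) − (U_k(s), g) = ∫ₛᵗ RHS(σ; U_k(σ), g) dσ`, the starting point of the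
  equicontinuity of the pairings (Aubin–Lions) and of the limit weak formulation;
* `abs_galerkinLinear_le`, `abs_galerkinTrilinear_le`, `abs_galerkinSource_le`,
  `abs_galerkinForm_le` — bounds of the right-hand side at a test field `V` against a fixed test
  field `g`, by Young's inequality with a parameter `λ` on each term:
  `|RHS(s; V, g)| ≤ 4λ ∫|DV|²_F + P + (4λ)⁻¹ Q` with `P`, `Q` depending only on `g`, on the
  bounds of `W`, `DW` on the support of `g`, on `∫ρ²` and on `∫|V|²` (Temam, Ch. III, §3,
  (3.43)–(3.48): "`∂ₜu_m` bounded in `L^{4/3}(0,T;V')`", in the elementary form needed here);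
* `exists_pairing_modulus` — **equicontinuity of the pairings, uniformly in the dimension**:
  `|(U_k(t), g) − (U_k(s), g)| ≤ K₁(t − s) + K₂√(t − s)` for `s ≤ t ≤ s + T`, with `K₁, K₂`
  independent of `k`, for every `g` in the Galerkin space and every `T`-periodic solution with
  the bounds of Lemma 2.6 (`λ = √(t − s)`; the dissipation over `[s, t]` is at most one period's
  worth) — the equicontinuity input of the Aubin–Lions extraction for `k → ∞`.

## Mathlib / tree search

Tree (all used): `galerkinSum`, `galerkinForm(_apply)`, `galerkinRHS`,
`galerkinRHS_apply_eq_galerkinForm`, `galerkinLinear_galerkinSum_right`,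
`galerkinTrilinear_galerkinSum_right`, `galerkinSource_galerkinSum`, `integral_inner_galerkinSum`,
`SliceRegular`, `exists_lipschitzOnWith_galerkinRHS`, `continuous_galerkinRHS`,
`integral_norm_sq_galerkinSum`, `isTestFunctionOn_galerkinSum` (`PeriodicLerayGalerkinSystem`);
`continuous_field_comp`, `continuous_dissipation_galerkinSum` (`PeriodicLerayGalerkin`);
`integrable_of_vanish`, `norm_apply_le_sqrt_frobenius_mul` (`PeriodicLerayGalerkinEnergy`).
Mathlib: `HasDerivAt.inner`, `intervalIntegral.integral_eq_sub_of_hasDerivAt`,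
`integral_mul_le_Lp_mul_Lq_of_nonneg`, `integral_sub_left_eq_self`,
`Function.Periodic.intervalIntegral_add_eq`, `intervalIntegral.integral_mono_interval`.

## References

* Z. Bradshaw, T.-P. Tsai, Ann. Henri Poincaré 18 (2017) = arXiv:1510.07504, §2 (weak
  formulation) and Lemma 2.6 [BradshawTsai2017AHP].
* R. Temam, *Navier–Stokes equations* (1977/79), Ch. III, §3, (3.43)–(3.46) [Temam1979].
-/

noncomputable section

open MeasureTheory Set Function Filter Topology TopologicalSpace Metric Module
open scoped NNReal ENNReal InnerProductSpace RealInnerProductSpace Convolution ContDiff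

namespace Literature.Analysis.FluidPDE

namespace BradshawTsai2017

variable {k : ℕ} {T : ℝ} {W : ℝ → EuclideanSpace ℝ (Fin 3) → EuclideanSpace ℝ (Fin 3)}
  {a : Fin k → EuclideanSpace ℝ (Fin 3) → EuclideanSpace ℝ (Fin 3)}
  {ρ : EuclideanSpace ℝ (Fin 3) → ℝ} {s : ℝ}

/-! ### Linearity of the right-hand side in the test slot -/

/-- **Linearity of the right-hand side of the weak formulation in the test field** over a family
of test fields: `RHS(s; U, Σⱼ cⱼaⱼ) = Σⱼ cⱼ RHS(s; U, aⱼ)` for a `C¹` velocity `U`. [folklore] -/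
theorem galerkinForm_galerkinSum_right (hρ : Continuous ρ) (hρc : HasCompactSupport ρ)
    (ha : ∀ i, FunctionSpaces.IsTestFunctionOn (⊤ : Opens (EuclideanSpace ℝ (Fin 3))) (a i))
    (hW : SliceRegular W s) {U : EuclideanSpace ℝ (Fin 3) → EuclideanSpace ℝ (Fin 3)}
    (hU : ContDiff ℝ 1 U) (c : EuclideanSpace ℝ (Fin k)) :
    galerkinForm W ρ s U (galerkinSum a c) = ∑ j, c j * galerkinForm W ρ s U (a j) := by
  rw [galerkinForm_apply, galerkinLinear_galerkinSum_right ha hU hW.continuous hW.continuous_fderiv c,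
    galerkinTrilinear_galerkinSum_right hρ hρc ha hU.continuous hU c,
    galerkinSource_galerkinSum ha hW.continuous hW.continuous_timeDeriv hW.continuous_fderiv c,
    ← Finset.sum_add_distrib, ← Finset.sum_add_distrib]
  refine Finset.sum_congr rfl fun j _ => ?_
  rw [galerkinForm_apply]
  ring

/-- **`⟪F(s, β), c⟫ = RHS(s; Σᵢ βᵢaᵢ, Σⱼ cⱼaⱼ)`**: pairing the Galerkin vector field with a
coefficient vector is the right-hand side of the weak formulation at the ansatz, tested against
the corresponding element of the Galerkin space. [cite: BradshawTsai2017AHP, §2 (the system of ODEs as the weak formulation on span{a₁,…,a_k})] -/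
theorem inner_galerkinRHS_eq_galerkinForm_pair (hρ : Continuous ρ) (hρc : HasCompactSupport ρ)
    (ha : ∀ i, FunctionSpaces.IsTestFunctionOn (⊤ : Opens (EuclideanSpace ℝ (Fin 3))) (a i))
    (hW : SliceRegular W s) (β c : EuclideanSpace ℝ (Fin k)) :
    ⟪galerkinRHS W ρ a s β, c⟫ = galerkinForm W ρ s (galerkinSum a β) (galerkinSum a c) := by
  have hU1 : ContDiff ℝ 1 (galerkinSum a β) :=
    (contDiff_galerkinSum (fun i => (ha i).contDiff) β).of_le (by exact_mod_cast le_top)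
  have h1 : ⟪galerkinRHS W ρ a s β, c⟫ = ∑ j, c j * galerkinRHS W ρ a s β j := by
    simp [PiLp.inner_apply]
  rw [h1, galerkinForm_galerkinSum_right hρ hρc ha hW hU1 c]
  refine Finset.sum_congr rfl fun j _ => ?_
  rw [galerkinRHS_apply_eq_galerkinForm hρ hρc ha hW β j]

/-! ### The weak formulation along a solution of the Galerkin system -/

variable {b : ℝ → EuclideanSpace ℝ (Fin k)}

/-- **`d/ds (U_k(s), g) = RHS(s; U_k(s), g)` for `g` in the Galerkin space.** Let `a` be an
`L²`-orthonormal family of test fields and `b` a solution of the Galerkin system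
(`b' = F(s, b)`). Then for every coefficient vector `c`, with `U_k(s) = Σᵢ bᵢ(s)aᵢ` and
`g = Σⱼ cⱼaⱼ`, the pairing `s ↦ (U_k(s), g) = ⟪b(s), c⟫` is differentiable with derivative
`RHS(s; U_k(s), g)` — the weak formulation of the mollified perturbed Leray system on the
Galerkin space. [cite: BradshawTsai2017AHP, §2 (weak formulation; the system of ODEs before Lemma 2.6)] -/
theorem hasDerivAt_pairing_galerkinSum (hρ : Continuous ρ) (hρc : HasCompactSupport ρ)
    (ha : ∀ i, FunctionSpaces.IsTestFunctionOn (⊤ : Opens (EuclideanSpace ℝ (Fin 3))) (a i))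
    (hon : ∀ i j, ∫ y, ⟪a i y, a j y⟫ = if i = j then (1 : ℝ) else 0)
    (hW : SliceRegular W s) (hb : HasDerivAt b (galerkinRHS W ρ a s (b s)) s)
    (c : EuclideanSpace ℝ (Fin k)) :
    HasDerivAt (fun σ => ∫ y, ⟪galerkinSum a (b σ) y, galerkinSum a c y⟫)
      (galerkinForm W ρ s (galerkinSum a (b s)) (galerkinSum a c)) s := by
  have hac : ∀ i, Continuous (a i) := fun i => (ha i).contDiff.continuous
  have has : ∀ i, HasCompactSupport (a i) := fun i => (ha i).hasCompactSupport
  have e : (fun σ => ∫ y, ⟪galerkinSum a (b σ) y, galerkinSum a c y⟫) = fun σ => ⟪b σ, c⟫ :=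
    funext fun σ => integral_inner_galerkinSum hac has hon (b σ) c
  rw [e, ← inner_galerkinRHS_eq_galerkinForm_pair hρ hρc ha hW (b s) c]
  have h := hb.inner ℝ (hasDerivAt_const s c)
  simpa using h

/-- **Continuity of `s ↦ RHS(s; U_k(s), g)` along a solution of the Galerkin system** (the
Galerkin vector field is continuous in `s` and Lipschitz in the state on the ball containing the
bounded solution, uniformly in `s`: `W ∈ C¹`, `T`-periodic). [folklore] -/
theorem continuous_galerkinForm_along (hT : 0 < T) (hW : ContDiff ℝ 1 (uncurry W))
    (hper : ∀ s y, W (s + T) y = W s y) (hρ : Continuous ρ) (hρc : HasCompactSupport ρ)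
    (ha : ∀ i, FunctionSpaces.IsTestFunctionOn (⊤ : Opens (EuclideanSpace ℝ (Fin 3))) (a i))
    (hb : ∀ s, HasDerivAt b (galerkinRHS W ρ a s (b s)) s) {R : ℝ}
    (hbR : ∀ s, b s ∈ closedBall (0 : EuclideanSpace ℝ (Fin k)) R) (c : EuclideanSpace ℝ (Fin k)) :
    Continuous fun s => galerkinForm W ρ s (galerkinSum a (b s)) (galerkinSum a c) := by
  have hbc : Continuous b := continuous_iff_continuousAt.2 fun s => (hb s).continuousAt
  obtain ⟨K, hK⟩ := exists_lipschitzOnWith_galerkinRHS hT hW hper ha ρ R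
  have hvb : Continuous fun s => galerkinRHS W ρ a s (b s) :=
    continuous_field_comp hbc hbR hK fun x => continuous_galerkinRHS hW ha x
  have e : (fun s => galerkinForm W ρ s (galerkinSum a (b s)) (galerkinSum a c)) =
      fun s => ⟪galerkinRHS W ρ a s (b s), c⟫ :=
    funext fun s => (inner_galerkinRHS_eq_galerkinForm_pair hρ hρc ha
      (SliceRegular.of_contDiff hW s) (b s) c).symm
  rw [e]
  exact hvb.inner continuous_const

/-- **The integrated weak formulation on the Galerkin space**: along a solution of the Galerkin
system over an `L²`-orthonormal family of test fields, for every `g = Σⱼ cⱼaⱼ` and all `s, t`,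
`∫ₛᵗ RHS(σ; U_k(σ), g) dσ = (U_k(t), g) − (U_k(s), g)`. [cite: BradshawTsai2017AHP, §2 (weak formulation) and Lemma 2.6; Temam1979, Ch. III §3 (3.43)–(3.46)] -/
theorem integral_galerkinForm_eq_pairing_sub (hT : 0 < T) (hW : ContDiff ℝ 1 (uncurry W))
    (hper : ∀ s y, W (s + T) y = W s y) (hρ : Continuous ρ) (hρc : HasCompactSupport ρ)
    (ha : ∀ i, FunctionSpaces.IsTestFunctionOn (⊤ : Opens (EuclideanSpace ℝ (Fin 3))) (a i))
    (hon : ∀ i j, ∫ y, ⟪a i y, a j y⟫ = if i = j then (1 : ℝ) else 0)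
    (hb : ∀ s, HasDerivAt b (galerkinRHS W ρ a s (b s)) s) {R : ℝ}
    (hbR : ∀ s, b s ∈ closedBall (0 : EuclideanSpace ℝ (Fin k)) R) (c : EuclideanSpace ℝ (Fin k))
    (s t : ℝ) :
    ∫ σ in s..t, galerkinForm W ρ σ (galerkinSum a (b σ)) (galerkinSum a c) =
      (∫ y, ⟪galerkinSum a (b t) y, galerkinSum a c y⟫) -
        ∫ y, ⟪galerkinSum a (b s) y, galerkinSum a c y⟫ :=
  intervalIntegral.integral_eq_sub_of_hasDerivAt
    (fun σ _ => hasDerivAt_pairing_galerkinSum hρ hρc ha hon (SliceRegular.of_contDiff hW σ) (hb σ) c)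
    ((continuous_galerkinForm_along hT hW hper hρ hρc ha hb hbR c).intervalIntegrable _ _)

/-- **Every element of the Galerkin space is a combination of the orthonormal family**: if
`g = Σⱼ cⱼaⱼ` then `(U, g) = Σⱼ cⱼ (U, aⱼ)`; in particular the pairings of the approximants with a
fixed `g` in the Galerkin space are `⟪b(s), c⟫`. [folklore] -/
theorem integral_inner_galerkinSum_right
    (ha : ∀ i, FunctionSpaces.IsTestFunctionOn (⊤ : Opens (EuclideanSpace ℝ (Fin 3))) (a i))
    (hon : ∀ i j, ∫ y, ⟪a i y, a j y⟫ = if i = j then (1 : ℝ) else 0)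
    (β c : EuclideanSpace ℝ (Fin k)) :
    ∫ y, ⟪galerkinSum a β y, galerkinSum a c y⟫ = ⟪β, c⟫ :=
  integral_inner_galerkinSum (fun i => (ha i).contDiff.continuous) (fun i => (ha i).hasCompactSupport)
    hon β c

/-- **Uniform bound of the pairings**: `|(U_k(s), g)| ≤ ‖b(s)‖ ‖c‖` (Cauchy–Schwarz in the
coefficients). [folklore] -/
theorem abs_integral_inner_galerkinSum_le
    (ha : ∀ i, FunctionSpaces.IsTestFunctionOn (⊤ : Opens (EuclideanSpace ℝ (Fin 3))) (a i))
    (hon : ∀ i j, ∫ y, ⟪a i y, a j y⟫ = if i = j then (1 : ℝ) else 0)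
    (β c : EuclideanSpace ℝ (Fin k)) :
    |∫ y, ⟪galerkinSum a β y, galerkinSum a c y⟫| ≤ ‖β‖ * ‖c‖ := by
  rw [integral_inner_galerkinSum_right ha hon]
  exact abs_real_inner_le_norm _ _

/-! ### Pointwise Young inequalities for the terms of the right-hand side -/

/-- **Young's inequality with a parameter**: `x y ≤ λ x² + (4λ)⁻¹ y²` (`λ > 0`). [folklore] -/
theorem mul_le_young {x y lam : ℝ} (hlam : 0 < lam) :
    x * y ≤ lam * x ^ 2 + (4 * lam)⁻¹ * y ^ 2 := by
  have h : lam * x ^ 2 + (4 * lam)⁻¹ * y ^ 2 - x * y = (4 * lam)⁻¹ * (2 * lam * x - y) ^ 2 := by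
    field_simp
    ring
  nlinarith [sq_nonneg (2 * lam * x - y), inv_pos.2 (mul_pos four_pos hlam), h]

/-- **Young for the Frobenius pairing**: `|A : B| ≤ λ |A|²_F + (4λ)⁻¹ |B|²_F` (termwise
Cauchy–Schwarz over the frame and `mul_le_young`). [folklore] -/
theorem abs_frobeniusInner_le_young
    (A B : EuclideanSpace ℝ (Fin 3) →L[ℝ] EuclideanSpace ℝ (Fin 3)) {lam : ℝ} (hlam : 0 < lam) :
    |frobeniusInner A B| ≤ lam * frobeniusNormSq A + (4 * lam)⁻¹ * frobeniusNormSq B := by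
  unfold frobeniusInner frobeniusNormSq
  calc |∑ i, ⟪A (stdOrthonormalBasis ℝ (EuclideanSpace ℝ (Fin 3)) i),
          B (stdOrthonormalBasis ℝ (EuclideanSpace ℝ (Fin 3)) i)⟫|
      ≤ ∑ i, |⟪A (stdOrthonormalBasis ℝ (EuclideanSpace ℝ (Fin 3)) i),
          B (stdOrthonormalBasis ℝ (EuclideanSpace ℝ (Fin 3)) i)⟫| := Finset.abs_sum_le_sum_abs _ _
    _ ≤ ∑ i, (lam * ‖A (stdOrthonormalBasis ℝ (EuclideanSpace ℝ (Fin 3)) i)‖ ^ 2 +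
          (4 * lam)⁻¹ * ‖B (stdOrthonormalBasis ℝ (EuclideanSpace ℝ (Fin 3)) i)‖ ^ 2) :=
        Finset.sum_le_sum fun i _ => (abs_real_inner_le_norm _ _).trans (mul_le_young hlam)
    _ = lam * ∑ i, ‖A (stdOrthonormalBasis ℝ (EuclideanSpace ℝ (Fin 3)) i)‖ ^ 2 +
          (4 * lam)⁻¹ * ∑ i, ‖B (stdOrthonormalBasis ℝ (EuclideanSpace ℝ (Fin 3)) i)‖ ^ 2 := by
        rw [Finset.sum_add_distrib, Finset.mul_sum, Finset.mul_sum]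

/-- **Young for `⟪L v, w⟫`**: `|⟪L v, w⟫| ≤ λ |L|²_F + (4λ)⁻¹ (‖v‖ ‖w‖)²` (`‖L v‖ ≤ √|L|²_F ‖v‖`).
[folklore] -/
theorem abs_inner_apply_le_young (L : EuclideanSpace ℝ (Fin 3) →L[ℝ] EuclideanSpace ℝ (Fin 3))
    (v w : EuclideanSpace ℝ (Fin 3)) {lam : ℝ} (hlam : 0 < lam) :
    |⟪L v, w⟫| ≤ lam * frobeniusNormSq L + (4 * lam)⁻¹ * (‖v‖ * ‖w‖) ^ 2 := by
  have hF : 0 ≤ frobeniusNormSq L := frobeniusNormSq_nonneg L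
  calc |⟪L v, w⟫| ≤ ‖L v‖ * ‖w‖ := abs_real_inner_le_norm _ _
    _ ≤ Real.sqrt (frobeniusNormSq L) * ‖v‖ * ‖w‖ :=
        mul_le_mul_of_nonneg_right (norm_apply_le_sqrt_frobenius_mul L v) (norm_nonneg _)
    _ = Real.sqrt (frobeniusNormSq L) * (‖v‖ * ‖w‖) := by ring
    _ ≤ lam * Real.sqrt (frobeniusNormSq L) ^ 2 + (4 * lam)⁻¹ * (‖v‖ * ‖w‖) ^ 2 := mul_le_young hlam
    _ = lam * frobeniusNormSq L + (4 * lam)⁻¹ * (‖v‖ * ‖w‖) ^ 2 := by rw [Real.sq_sqrt hF]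

/-- **`|⟪v, w⟫| ≤ ½‖v‖² + ½‖w‖²`.** [folklore] -/
theorem abs_inner_le_half_sq_add (v w : EuclideanSpace ℝ (Fin 3)) :
    |⟪v, w⟫| ≤ 1 / 2 * ‖v‖ ^ 2 + 1 / 2 * ‖w‖ ^ 2 := by
  refine (abs_real_inner_le_norm v w).trans ?_
  nlinarith [sq_nonneg (‖v‖ - ‖w‖)]

/-! ### Uniform bounds of the profile on `ℝ × B̄(0, R)` -/

/-- **A continuous `T`-periodic profile and its slice derivative are bounded on `ℝ × B̄(0, R)`**
(compactness of `[0, T] × B̄(0, R)` and periodicity). [folklore] -/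
theorem exists_profile_bound_of_periodic (hT : 0 < T) (hW : ContDiff ℝ 1 (uncurry W))
    (hper : ∀ s y, W (s + T) y = W s y) (R : ℝ) :
    ∃ M : ℝ, 0 ≤ M ∧ (∀ s, ∀ y ∈ closedBall (0 : EuclideanSpace ℝ (Fin 3)) R, ‖W s y‖ ≤ M) ∧
      ∀ s, ∀ y ∈ closedBall (0 : EuclideanSpace ℝ (Fin 3)) R, ‖fderiv ℝ (W s) y‖ ≤ M := by
  have hK : IsCompact (Icc 0 T ×ˢ closedBall (0 : EuclideanSpace ℝ (Fin 3)) R) :=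
    isCompact_Icc.prod (isCompact_closedBall 0 R)
  obtain ⟨M₁, hM₁⟩ := hK.exists_bound_of_continuousOn hW.continuous.continuousOn
  obtain ⟨M₂, hM₂⟩ := hK.exists_bound_of_continuousOn (continuous_fderiv_slice hW).continuousOn
  have hp : Function.Periodic W T := fun s => funext (hper s)
  refine ⟨max (max M₁ M₂) 0, le_max_right _ _, fun s y hy => ?_, fun s y hy => ?_⟩
  · obtain ⟨s', hs', hs⟩ := hp.exists_mem_Ico₀ hT s
    have e : W s y = W s' y := by rw [hs]
    rw [e]
    exact (hM₁ (s', y) ⟨Ico_subset_Icc_self hs', hy⟩).trans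
      ((le_max_left _ _).trans (le_max_left _ _))
  · obtain ⟨s', hs', hs⟩ := hp.exists_mem_Ico₀ hT s
    have e : fderiv ℝ (W s) y = fderiv ℝ (W s') y := by rw [hs]
    rw [e]
    exact (hM₂ (s', y) ⟨Ico_subset_Icc_self hs', hy⟩).trans
      ((le_max_right _ _).trans (le_max_left _ _))

/-- A test field vanishes, together with its derivative, outside some closed ball `B̄(0, R)`,
`R > 0`. [folklore] -/
theorem exists_closedBall_of_isTestFunctionOn {g : EuclideanSpace ℝ (Fin 3) → EuclideanSpace ℝ (Fin 3)}
    (hg : FunctionSpaces.IsTestFunctionOn (⊤ : Opens (EuclideanSpace ℝ (Fin 3))) g) :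
    ∃ R : ℝ, 0 < R ∧ tsupport g ⊆ closedBall (0 : EuclideanSpace ℝ (Fin 3)) R ∧
      ∀ y, y ∉ closedBall (0 : EuclideanSpace ℝ (Fin 3)) R → g y = 0 ∧ fderiv ℝ g y = 0 := by
  obtain ⟨R₀, hR₀⟩ := hg.hasCompactSupport.isCompact.isBounded.subset_closedBall
    (0 : EuclideanSpace ℝ (Fin 3))
  refine ⟨|R₀| + 1, by positivity, hR₀.trans (closedBall_subset_closedBall
    (by linarith [le_abs_self R₀])), fun y hy => ?_⟩
  have hy' : y ∉ tsupport g := fun h => hy (closedBall_subset_closedBall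
    (by linarith [le_abs_self R₀]) (hR₀ h))
  exact ⟨image_eq_zero_of_notMem_tsupport hy', fderiv_of_notMem_tsupport ℝ hy'⟩

/-! ### Bounds of the three pairings of the right-hand side -/

section Bounds

variable {V Z : EuclideanSpace ℝ (Fin 3) → EuclideanSpace ℝ (Fin 3)} {R M lam : ℝ}

/-- **Pointwise bound of the linear integrand**: if `|W(s)|, |DW(s)| ≤ M` on `B̄(0, R)` and the
test field `Z` vanishes with its derivative off `B̄(0, R)`, then for every `λ > 0`
`|−DV:DZ + ⟪V + (y·∇)V − (W·∇)V − (V·∇)W, Z⟫| ≤ 3λ|DV|²_F + (½ + ½M²)|V|²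
  + (4λ)⁻¹(|DZ|²_F + |y|²|Z|² + M²|Z|²) + |Z|²` (Young on each term). [folklore] -/
theorem abs_linearIntegrand_le
    (hM : ∀ y ∈ closedBall (0 : EuclideanSpace ℝ (Fin 3)) R, ‖W s y‖ ≤ M ∧ ‖fderiv ℝ (W s) y‖ ≤ M)
    (hZ0 : ∀ y, y ∉ closedBall (0 : EuclideanSpace ℝ (Fin 3)) R → Z y = 0 ∧ fderiv ℝ Z y = 0)
    (hlam : 0 < lam) (y : EuclideanSpace ℝ (Fin 3)) :
    |linearIntegrand W s V Z y| ≤ 3 * lam * frobeniusNormSq (fderiv ℝ V y) +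
      (1 / 2 + 1 / 2 * M ^ 2) * ‖V y‖ ^ 2 +
      (4 * lam)⁻¹ * (frobeniusNormSq (fderiv ℝ Z y) + ‖y‖ ^ 2 * ‖Z y‖ ^ 2 + M ^ 2 * ‖Z y‖ ^ 2) +
      ‖Z y‖ ^ 2 := by
  have hFV : 0 ≤ frobeniusNormSq (fderiv ℝ V y) := frobeniusNormSq_nonneg _
  have hFZ : 0 ≤ frobeniusNormSq (fderiv ℝ Z y) := frobeniusNormSq_nonneg _
  have h4 : 0 ≤ (4 * lam)⁻¹ := by positivity
  by_cases hy : y ∈ closedBall (0 : EuclideanSpace ℝ (Fin 3)) R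
  · obtain ⟨hWy, hDWy⟩ := hM y hy
    -- the five terms
    have t1 : |frobeniusInner (fderiv ℝ V y) (fderiv ℝ Z y)| ≤
        lam * frobeniusNormSq (fderiv ℝ V y) + (4 * lam)⁻¹ * frobeniusNormSq (fderiv ℝ Z y) :=
      abs_frobeniusInner_le_young _ _ hlam
    have t2 : |⟪V y, Z y⟫| ≤ 1 / 2 * ‖V y‖ ^ 2 + 1 / 2 * ‖Z y‖ ^ 2 := abs_inner_le_half_sq_add _ _
    have t3 : |⟪fderiv ℝ V y y, Z y⟫| ≤
        lam * frobeniusNormSq (fderiv ℝ V y) + (4 * lam)⁻¹ * (‖y‖ * ‖Z y‖) ^ 2 :=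
      abs_inner_apply_le_young _ _ _ hlam
    have t4 : |⟪fderiv ℝ V y (W s y), Z y⟫| ≤
        lam * frobeniusNormSq (fderiv ℝ V y) + (4 * lam)⁻¹ * (M * ‖Z y‖) ^ 2 := by
      refine (abs_inner_apply_le_young _ _ _ hlam).trans ?_
      gcongr
    have t5 : |⟪fderiv ℝ (W s) y (V y), Z y⟫| ≤ 1 / 2 * (M * ‖V y‖) ^ 2 + 1 / 2 * ‖Z y‖ ^ 2 := by
      refine (abs_inner_le_half_sq_add _ _).trans ?_
      have h : ‖fderiv ℝ (W s) y (V y)‖ ≤ M * ‖V y‖ :=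
        (ContinuousLinearMap.le_opNorm _ _).trans (mul_le_mul_of_nonneg_right hDWy (norm_nonneg _))
      gcongr
    -- the integrand split into the five terms
    have hsplit : |linearIntegrand W s V Z y| ≤ |frobeniusInner (fderiv ℝ V y) (fderiv ℝ Z y)| +
        |⟪V y, Z y⟫| + |⟪fderiv ℝ V y y, Z y⟫| + |⟪fderiv ℝ V y (W s y), Z y⟫| +
        |⟪fderiv ℝ (W s) y (V y), Z y⟫| := by
      have e : |linearIntegrand W s V Z y| = |-frobeniusInner (fderiv ℝ V y) (fderiv ℝ Z y) +
          ⟪V y, Z y⟫ + ⟪fderiv ℝ V y y, Z y⟫ + -⟪fderiv ℝ V y (W s y), Z y⟫ +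
          -⟪fderiv ℝ (W s) y (V y), Z y⟫| := by
        unfold linearIntegrand
        congr 1
        simp only [inner_add_left, inner_sub_left]
        ring
      rw [e]
      calc |-frobeniusInner (fderiv ℝ V y) (fderiv ℝ Z y) + ⟪V y, Z y⟫ + ⟪fderiv ℝ V y y, Z y⟫ +
            -⟪fderiv ℝ V y (W s y), Z y⟫ + -⟪fderiv ℝ (W s) y (V y), Z y⟫|
          ≤ |-frobeniusInner (fderiv ℝ V y) (fderiv ℝ Z y) + ⟪V y, Z y⟫ + ⟪fderiv ℝ V y y, Z y⟫ +
            -⟪fderiv ℝ V y (W s y), Z y⟫| + |-⟪fderiv ℝ (W s) y (V y), Z y⟫| := abs_add_le _ _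
        _ ≤ |-frobeniusInner (fderiv ℝ V y) (fderiv ℝ Z y) + ⟪V y, Z y⟫ + ⟪fderiv ℝ V y y, Z y⟫| +
            |-⟪fderiv ℝ V y (W s y), Z y⟫| + |-⟪fderiv ℝ (W s) y (V y), Z y⟫| :=
          by gcongr; exact abs_add_le _ _
        _ ≤ |-frobeniusInner (fderiv ℝ V y) (fderiv ℝ Z y) + ⟪V y, Z y⟫| + |⟪fderiv ℝ V y y, Z y⟫| +
            |-⟪fderiv ℝ V y (W s y), Z y⟫| + |-⟪fderiv ℝ (W s) y (V y), Z y⟫| :=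
          by gcongr; exact abs_add_le _ _
        _ ≤ |-frobeniusInner (fderiv ℝ V y) (fderiv ℝ Z y)| + |⟪V y, Z y⟫| + |⟪fderiv ℝ V y y, Z y⟫| +
            |-⟪fderiv ℝ V y (W s y), Z y⟫| + |-⟪fderiv ℝ (W s) y (V y), Z y⟫| :=
          by gcongr; exact abs_add_le _ _
        _ = |frobeniusInner (fderiv ℝ V y) (fderiv ℝ Z y)| + |⟪V y, Z y⟫| + |⟪fderiv ℝ V y y, Z y⟫| +
            |⟪fderiv ℝ V y (W s y), Z y⟫| + |⟪fderiv ℝ (W s) y (V y), Z y⟫| := by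
          rw [abs_neg, abs_neg, abs_neg]
    refine hsplit.trans ?_
    have hsum := add_le_add (add_le_add (add_le_add (add_le_add t1 t2) t3) t4) t5
    refine hsum.trans (le_of_eq ?_)
    ring
  · obtain ⟨hZy, hDZy⟩ := hZ0 y hy
    have h0 : linearIntegrand W s V Z y = 0 := by
      simp only [linearIntegrand, hZy, hDZy, frobeniusInner_zero_right, neg_zero, inner_zero_right,
        add_zero]
    rw [h0, abs_zero]
    positivity

/-- **Bound of the bilinear pairing `galerkinLinear`**: with `|W(s)|, |DW(s)| ≤ M` on `B̄(0,R)`,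
a test field `Z` supported in `B̄(0,R)` and a test field `V`, for every `λ > 0`,
`|galerkinLinear W s V Z| ≤ 3λ ∫|DV|²_F + (½ + ½M²) ∫|V|² + (4λ)⁻¹ K_Z + ∫|Z|²` with
`K_Z = ∫ (|DZ|²_F + |y|²|Z|² + M²|Z|²)`. [cite: Temam1979, Ch. III §3 (3.43)–(3.46) (bounds of the Galerkin right-hand side)] -/
theorem abs_galerkinLinear_le
    (hM : ∀ y ∈ closedBall (0 : EuclideanSpace ℝ (Fin 3)) R, ‖W s y‖ ≤ M ∧ ‖fderiv ℝ (W s) y‖ ≤ M)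
    (hWs : SliceRegular W s)
    (hV : FunctionSpaces.IsTestFunctionOn (⊤ : Opens (EuclideanSpace ℝ (Fin 3))) V)
    (hZ : FunctionSpaces.IsTestFunctionOn (⊤ : Opens (EuclideanSpace ℝ (Fin 3))) Z)
    (hZ0 : ∀ y, y ∉ closedBall (0 : EuclideanSpace ℝ (Fin 3)) R → Z y = 0 ∧ fderiv ℝ Z y = 0)
    (hlam : 0 < lam) :
    |galerkinLinear W s V Z| ≤ 3 * lam * (∫ y, frobeniusNormSq (fderiv ℝ V y)) +
      (1 / 2 + 1 / 2 * M ^ 2) * (∫ y, ‖V y‖ ^ 2) +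
      (4 * lam)⁻¹ * (∫ y, (frobeniusNormSq (fderiv ℝ Z y) + ‖y‖ ^ 2 * ‖Z y‖ ^ 2 + M ^ 2 * ‖Z y‖ ^ 2)) +
      ∫ y, ‖Z y‖ ^ 2 := by
  have hV1 : ContDiff ℝ 1 V := hV.contDiff.of_le (by exact_mod_cast le_top)
  have hZ1 : ContDiff ℝ 1 Z := hZ.contDiff.of_le (by exact_mod_cast le_top)
  have hDVc : Continuous (fderiv ℝ V) := hV1.continuous_fderiv one_ne_zero
  have hDZc : Continuous (fderiv ℝ Z) := hZ1.continuous_fderiv one_ne_zero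
  -- integrability of the bound
  have iFV : Integrable (fun y => frobeniusNormSq (fderiv ℝ V y)) (volume : Measure (EuclideanSpace ℝ (Fin 3))) :=
    integrable_of_vanish (continuous_frobeniusNormSq_comp hDVc) hV.hasCompactSupport fun y hy => by
      rw [fderiv_eq_zero_of_notMem hy, frobeniusNormSq_zero]
  have iV2 : Integrable (fun y => ‖V y‖ ^ 2) (volume : Measure (EuclideanSpace ℝ (Fin 3))) :=
    integrable_of_vanish (hV.contDiff.continuous.norm.pow 2) hV.hasCompactSupport fun y hy => by
      rw [image_eq_zero_of_notMem_tsupport hy, norm_zero, zero_pow two_ne_zero]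
  have iZ2 : Integrable (fun y => ‖Z y‖ ^ 2) (volume : Measure (EuclideanSpace ℝ (Fin 3))) :=
    integrable_of_vanish (hZ.contDiff.continuous.norm.pow 2) hZ.hasCompactSupport fun y hy => by
      rw [image_eq_zero_of_notMem_tsupport hy, norm_zero, zero_pow two_ne_zero]
  have iFZ : Integrable (fun y => frobeniusNormSq (fderiv ℝ Z y)) (volume : Measure (EuclideanSpace ℝ (Fin 3))) :=
    integrable_of_vanish (continuous_frobeniusNormSq_comp hDZc) hZ.hasCompactSupport fun y hy => by
      rw [fderiv_eq_zero_of_notMem hy, frobeniusNormSq_zero]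
  have iyZ : Integrable (fun y : EuclideanSpace ℝ (Fin 3) => ‖y‖ ^ 2 * ‖Z y‖ ^ 2)
      (volume : Measure (EuclideanSpace ℝ (Fin 3))) :=
    integrable_of_vanish ((continuous_norm.pow 2).mul (hZ.contDiff.continuous.norm.pow 2))
      hZ.hasCompactSupport fun y hy => by
      rw [image_eq_zero_of_notMem_tsupport hy, norm_zero, zero_pow two_ne_zero, mul_zero]
  have iK : Integrable (fun y : EuclideanSpace ℝ (Fin 3) => frobeniusNormSq (fderiv ℝ Z y) +
      ‖y‖ ^ 2 * ‖Z y‖ ^ 2 + M ^ 2 * ‖Z y‖ ^ 2) (volume : Measure (EuclideanSpace ℝ (Fin 3))) :=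
    (iFZ.add iyZ).add (iZ2.const_mul _)
  have i12 : Integrable (fun y => 3 * lam * frobeniusNormSq (fderiv ℝ V y) +
      (1 / 2 + 1 / 2 * M ^ 2) * ‖V y‖ ^ 2) (volume : Measure (EuclideanSpace ℝ (Fin 3))) :=
    (iFV.const_mul _).add (iV2.const_mul _)
  have i123 : Integrable (fun y => 3 * lam * frobeniusNormSq (fderiv ℝ V y) +
      (1 / 2 + 1 / 2 * M ^ 2) * ‖V y‖ ^ 2 +
      (4 * lam)⁻¹ * (frobeniusNormSq (fderiv ℝ Z y) + ‖y‖ ^ 2 * ‖Z y‖ ^ 2 + M ^ 2 * ‖Z y‖ ^ 2))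
      (volume : Measure (EuclideanSpace ℝ (Fin 3))) := i12.add (iK.const_mul _)
  have ibound : Integrable (fun y => 3 * lam * frobeniusNormSq (fderiv ℝ V y) +
      (1 / 2 + 1 / 2 * M ^ 2) * ‖V y‖ ^ 2 +
      (4 * lam)⁻¹ * (frobeniusNormSq (fderiv ℝ Z y) + ‖y‖ ^ 2 * ‖Z y‖ ^ 2 + M ^ 2 * ‖Z y‖ ^ 2) +
      ‖Z y‖ ^ 2) (volume : Measure (EuclideanSpace ℝ (Fin 3))) := i123.add iZ2
  calc |galerkinLinear W s V Z| = ‖∫ y, linearIntegrand W s V Z y‖ := (Real.norm_eq_abs _).symm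
    _ ≤ ∫ y, ‖linearIntegrand W s V Z y‖ := norm_integral_le_integral_norm _
    _ ≤ ∫ y, (3 * lam * frobeniusNormSq (fderiv ℝ V y) + (1 / 2 + 1 / 2 * M ^ 2) * ‖V y‖ ^ 2 +
          (4 * lam)⁻¹ * (frobeniusNormSq (fderiv ℝ Z y) + ‖y‖ ^ 2 * ‖Z y‖ ^ 2 + M ^ 2 * ‖Z y‖ ^ 2) +
          ‖Z y‖ ^ 2) := by
        refine integral_mono (integrable_linearIntegrand hV1 hZ1 hZ.hasCompactSupport hWs.continuous
          hWs.continuous_fderiv).norm ibound fun y => ?_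
        rw [Real.norm_eq_abs]
        exact abs_linearIntegrand_le hM hZ0 hlam y
    _ = 3 * lam * (∫ y, frobeniusNormSq (fderiv ℝ V y)) + (1 / 2 + 1 / 2 * M ^ 2) * (∫ y, ‖V y‖ ^ 2) +
          (4 * lam)⁻¹ * (∫ y, (frobeniusNormSq (fderiv ℝ Z y) + ‖y‖ ^ 2 * ‖Z y‖ ^ 2 +
            M ^ 2 * ‖Z y‖ ^ 2)) + ∫ y, ‖Z y‖ ^ 2 := by
        rw [integral_add i123 iZ2, integral_add i12 (iK.const_mul _),
          integral_add (iFV.const_mul _) (iV2.const_mul _), integral_const_mul, integral_const_mul,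
          integral_const_mul]

/-- **Bound of the trilinear pairing**: if `|(ρ ⋆ V)(y)| ≤ B` for all `y` and `Z` is a test
field, then for every `λ > 0`, `|galerkinTrilinear ρ V V Z| ≤ λ ∫|DV|²_F + (4λ)⁻¹ B² ∫|Z|²`.
[cite: Temam1979, Ch. III §3 (3.43)–(3.46) (bounds of the Galerkin right-hand side)] -/
theorem abs_galerkinTrilinear_le (hρ : Continuous ρ) (hρc : HasCompactSupport ρ)
    (hV : FunctionSpaces.IsTestFunctionOn (⊤ : Opens (EuclideanSpace ℝ (Fin 3))) V)
    (hZ : FunctionSpaces.IsTestFunctionOn (⊤ : Opens (EuclideanSpace ℝ (Fin 3))) Z) {B : ℝ}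
    (hB : ∀ y, ‖(ρ ⋆[ContinuousLinearMap.lsmul ℝ ℝ, volume] V) y‖ ≤ B) (hlam : 0 < lam) :
    |galerkinTrilinear ρ V V Z| ≤ lam * (∫ y, frobeniusNormSq (fderiv ℝ V y)) +
      (4 * lam)⁻¹ * B ^ 2 * ∫ y, ‖Z y‖ ^ 2 := by
  have hV1 : ContDiff ℝ 1 V := hV.contDiff.of_le (by exact_mod_cast le_top)
  have hDVc : Continuous (fderiv ℝ V) := hV1.continuous_fderiv one_ne_zero
  have iFV : Integrable (fun y => frobeniusNormSq (fderiv ℝ V y)) (volume : Measure (EuclideanSpace ℝ (Fin 3))) :=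
    integrable_of_vanish (continuous_frobeniusNormSq_comp hDVc) hV.hasCompactSupport fun y hy => by
      rw [fderiv_eq_zero_of_notMem hy, frobeniusNormSq_zero]
  have iZ2 : Integrable (fun y => ‖Z y‖ ^ 2) (volume : Measure (EuclideanSpace ℝ (Fin 3))) :=
    integrable_of_vanish (hZ.contDiff.continuous.norm.pow 2) hZ.hasCompactSupport fun y hy => by
      rw [image_eq_zero_of_notMem_tsupport hy, norm_zero, zero_pow two_ne_zero]
  have hpt : ∀ y, |⟪fderiv ℝ V y ((ρ ⋆[ContinuousLinearMap.lsmul ℝ ℝ, volume] V) y), Z y⟫| ≤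
      lam * frobeniusNormSq (fderiv ℝ V y) + (4 * lam)⁻¹ * B ^ 2 * ‖Z y‖ ^ 2 := fun y => by
    refine (abs_inner_apply_le_young _ _ _ hlam).trans ?_
    rw [mul_assoc ((4 * lam)⁻¹)]
    gcongr
    rw [mul_pow]
    gcongr
    exact hB y
  unfold galerkinTrilinear
  rw [abs_neg]
  calc |∫ y, ⟪fderiv ℝ V y ((ρ ⋆[ContinuousLinearMap.lsmul ℝ ℝ, volume] V) y), Z y⟫|
      = ‖∫ y, ⟪fderiv ℝ V y ((ρ ⋆[ContinuousLinearMap.lsmul ℝ ℝ, volume] V) y), Z y⟫‖ :=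
        (Real.norm_eq_abs _).symm
    _ ≤ ∫ y, ‖⟪fderiv ℝ V y ((ρ ⋆[ContinuousLinearMap.lsmul ℝ ℝ, volume] V) y), Z y⟫‖ :=
        norm_integral_le_integral_norm _
    _ ≤ ∫ y, (lam * frobeniusNormSq (fderiv ℝ V y) + (4 * lam)⁻¹ * B ^ 2 * ‖Z y‖ ^ 2) := by
        refine integral_mono (integrable_trilinearIntegrand hρ hρc hV.contDiff.continuous hV1
          hZ.contDiff.continuous hZ.hasCompactSupport).norm
          ((iFV.const_mul _).add (iZ2.const_mul _)) fun y => ?_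
        rw [Real.norm_eq_abs]
        exact hpt y
    _ = lam * (∫ y, frobeniusNormSq (fderiv ℝ V y)) + (4 * lam)⁻¹ * B ^ 2 * ∫ y, ‖Z y‖ ^ 2 := by
        rw [integral_add (iFV.const_mul _) (iZ2.const_mul _), integral_const_mul, integral_const_mul]

/-- **Bound of the source pairing**: with `|W(s)|, |DW(s)| ≤ M` on `B̄(0,R)`, `Z` a test field
supported in `B̄(0,R)` and `|⟨LW(s), Z⟩| ≤ C_ℓ`,
`|galerkinSource W s Z| ≤ C_ℓ + M² ∫|Z|`. [cite: BradshawTsai2017AHP, proof of Lemma 2.6 ("|(ℛ(W), U_k)| ≤ (‖LW‖_{H⁻¹} + ‖W‖²_{L⁴})‖U_k‖_{H¹}")] -/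
theorem abs_galerkinSource_le (hM0 : 0 ≤ M)
    (hM : ∀ y ∈ closedBall (0 : EuclideanSpace ℝ (Fin 3)) R, ‖W s y‖ ≤ M ∧ ‖fderiv ℝ (W s) y‖ ≤ M)
    (hWs : SliceRegular W s)
    (hZ : FunctionSpaces.IsTestFunctionOn (⊤ : Opens (EuclideanSpace ℝ (Fin 3))) Z)
    (hZ0 : ∀ y, y ∉ closedBall (0 : EuclideanSpace ℝ (Fin 3)) R → Z y = 0 ∧ fderiv ℝ Z y = 0)
    {Cℓ : ℝ} (hℓ : |lerayPairing W s Z| ≤ Cℓ) :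
    |galerkinSource W s Z| ≤ Cℓ + M ^ 2 * ∫ y, ‖Z y‖ := by
  have iZ1 : Integrable (fun y => ‖Z y‖) (volume : Measure (EuclideanSpace ℝ (Fin 3))) :=
    integrable_of_vanish hZ.contDiff.continuous.norm hZ.hasCompactSupport fun y hy => by
      rw [image_eq_zero_of_notMem_tsupport hy, norm_zero]
  have hpt : ∀ y, |⟪fderiv ℝ (W s) y (W s y), Z y⟫| ≤ M ^ 2 * ‖Z y‖ := fun y => by
    by_cases hy : y ∈ closedBall (0 : EuclideanSpace ℝ (Fin 3)) R
    · obtain ⟨hWy, hDWy⟩ := hM y hy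
      calc |⟪fderiv ℝ (W s) y (W s y), Z y⟫| ≤ ‖fderiv ℝ (W s) y (W s y)‖ * ‖Z y‖ :=
            abs_real_inner_le_norm _ _
        _ ≤ (M * M) * ‖Z y‖ := by
            refine mul_le_mul_of_nonneg_right ?_ (norm_nonneg _)
            exact (ContinuousLinearMap.le_opNorm _ _).trans (mul_le_mul hDWy hWy (norm_nonneg _) hM0)
        _ = M ^ 2 * ‖Z y‖ := by ring
    · rw [(hZ0 y hy).1, inner_zero_right, abs_zero]
      positivity
  unfold galerkinSource
  calc |-lerayPairing W s Z - ∫ y, ⟪fderiv ℝ (W s) y (W s y), Z y⟫|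
      ≤ |-lerayPairing W s Z| + |∫ y, ⟪fderiv ℝ (W s) y (W s y), Z y⟫| := abs_sub _ _
    _ ≤ Cℓ + M ^ 2 * ∫ y, ‖Z y‖ := by
        refine add_le_add (by rwa [abs_neg]) ?_
        calc |∫ y, ⟪fderiv ℝ (W s) y (W s y), Z y⟫|
            = ‖∫ y, ⟪fderiv ℝ (W s) y (W s y), Z y⟫‖ := (Real.norm_eq_abs _).symm
          _ ≤ ∫ y, ‖⟪fderiv ℝ (W s) y (W s y), Z y⟫‖ := norm_integral_le_integral_norm _
          _ ≤ ∫ y, M ^ 2 * ‖Z y‖ := by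
              refine integral_mono (integrable_inner_convect_profile hZ.contDiff.continuous
                hZ.hasCompactSupport hWs.continuous hWs.continuous_fderiv).norm (iZ1.const_mul _)
                fun y => ?_
              rw [Real.norm_eq_abs]
              exact hpt y
          _ = M ^ 2 * ∫ y, ‖Z y‖ := integral_const_mul _ _

end Bounds

/-! ### The sup bound of the mollified ansatz -/

/-- **`|(ρ ⋆ V)(y)|² ≤ (∫ ρ²)(∫ |V|²)`** for continuous compactly supported `ρ`, `V`
(Cauchy–Schwarz and translation invariance). [folklore] -/
theorem norm_sq_convolution_le (hρ : Continuous ρ) (hρc : HasCompactSupport ρ)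
    {V : EuclideanSpace ℝ (Fin 3) → EuclideanSpace ℝ (Fin 3)} (hV : Continuous V)
    (hVc : HasCompactSupport V) (y : EuclideanSpace ℝ (Fin 3)) :
    ‖(ρ ⋆[ContinuousLinearMap.lsmul ℝ ℝ, volume] V) y‖ ^ 2 ≤ (∫ t, ρ t ^ 2) * ∫ t, ‖V t‖ ^ 2 := by
  have hpq : (2 : ℝ).HolderConjugate 2 := Real.holderConjugate_iff.2 ⟨by norm_num, by norm_num⟩
  -- the two factors `|ρ|` and `‖V(y - ·)‖`
  have hVy : Continuous fun t => ‖V (y - t)‖ := (hV.comp (continuous_const.sub continuous_id)).norm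
  have hVyc : HasCompactSupport fun t => ‖V (y - t)‖ :=
    (hVc.comp_homeomorph (Homeomorph.subLeft y)).norm
  have hf : MemLp (fun t => |ρ t|) (ENNReal.ofReal 2) (volume : Measure (EuclideanSpace ℝ (Fin 3))) :=
    (continuous_abs.comp hρ).memLp_of_hasCompactSupport (hρc.comp_left (g := fun r : ℝ => |r|) (by simp))
  have hgm : MemLp (fun t => ‖V (y - t)‖) (ENNReal.ofReal 2) (volume : Measure (EuclideanSpace ℝ (Fin 3))) :=
    hVy.memLp_of_hasCompactSupport hVyc
  have h1 : ‖(ρ ⋆[ContinuousLinearMap.lsmul ℝ ℝ, volume] V) y‖ ≤ ∫ t, |ρ t| * ‖V (y - t)‖ := by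
    rw [convolution_def]
    refine (norm_integral_le_integral_norm _).trans (le_of_eq ?_)
    refine integral_congr_ae (Eventually.of_forall fun t => ?_)
    simp only [ContinuousLinearMap.lsmul_apply, norm_smul, Real.norm_eq_abs]
  have h2 := integral_mul_le_Lp_mul_Lq_of_nonneg hpq (Eventually.of_forall fun t => abs_nonneg _)
    (Eventually.of_forall fun t => norm_nonneg _) hf hgm
  -- squares
  have hA : 0 ≤ ∫ t, |ρ t| ^ (2 : ℝ) := integral_nonneg fun t => by positivity
  have hB : 0 ≤ ∫ t, ‖V (y - t)‖ ^ (2 : ℝ) := integral_nonneg fun t => by positivity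
  have eA : ∫ t, |ρ t| ^ (2 : ℝ) = ∫ t, ρ t ^ 2 :=
    integral_congr_ae (Eventually.of_forall fun t => by simp [sq_abs])
  have eB : ∫ t, ‖V (y - t)‖ ^ (2 : ℝ) = ∫ t, ‖V t‖ ^ 2 := by
    have e1 : ∫ t, ‖V (y - t)‖ ^ (2 : ℝ) = ∫ t, ‖V (y - t)‖ ^ 2 :=
      integral_congr_ae (Eventually.of_forall fun t => by simp)
    rw [e1]
    exact integral_sub_left_eq_self (fun t => ‖V t‖ ^ 2) volume y
  have h0 : 0 ≤ ‖(ρ ⋆[ContinuousLinearMap.lsmul ℝ ℝ, volume] V) y‖ := norm_nonneg _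
  have h3 : ‖(ρ ⋆[ContinuousLinearMap.lsmul ℝ ℝ, volume] V) y‖ ≤
      (∫ t, |ρ t| ^ (2 : ℝ)) ^ (1 / (2 : ℝ)) * (∫ t, ‖V (y - t)‖ ^ (2 : ℝ)) ^ (1 / (2 : ℝ)) :=
    h1.trans h2
  calc ‖(ρ ⋆[ContinuousLinearMap.lsmul ℝ ℝ, volume] V) y‖ ^ 2
      ≤ ((∫ t, |ρ t| ^ (2 : ℝ)) ^ (1 / (2 : ℝ)) * (∫ t, ‖V (y - t)‖ ^ (2 : ℝ)) ^ (1 / (2 : ℝ))) ^ 2 :=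
        pow_le_pow_left₀ h0 h3 2
    _ = (∫ t, |ρ t| ^ (2 : ℝ)) * ∫ t, ‖V (y - t)‖ ^ (2 : ℝ) := by
        rw [mul_pow, ← Real.sqrt_eq_rpow, ← Real.sqrt_eq_rpow, Real.sq_sqrt hA, Real.sq_sqrt hB]
    _ = (∫ t, ρ t ^ 2) * ∫ t, ‖V t‖ ^ 2 := by rw [eA, eB]

/-! ### The equicontinuity modulus of the pairings with the Galerkin space -/

section Modulus

variable {V Z : EuclideanSpace ℝ (Fin 3) → EuclideanSpace ℝ (Fin 3)} {R M lam : ℝ}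

/-- **Bound of the right-hand side along the approximants.** With the notation of
`abs_galerkinLinear_le` and a test field `Z` supported in `B̄(0,R)`, for a test field `V` with
`∫|V|² ≤ C_b`, `|(ρ ⋆ V)(y)|² ≤ N C_b` (`N = ∫ρ²`) and `|⟨LW(s), Z⟩| ≤ C_ℓ`, for every `λ > 0`:
`|RHS(s; V, Z)| ≤ 4λ ∫|DV|²_F + P + (4λ)⁻¹ Q`, `P = (½ + ½M²)C_b + ∫|Z|² + C_ℓ + M²∫|Z|`,
`Q = ∫(|DZ|²_F + |y|²|Z|² + M²|Z|²) + N C_b ∫|Z|²`. [cite: Temam1979, Ch. III §3 (3.43)–(3.46) (bounds of the Galerkin right-hand side)] -/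
theorem abs_galerkinForm_le (hρ : Continuous ρ) (hρc : HasCompactSupport ρ) (hM0 : 0 ≤ M)
    (hM : ∀ y ∈ closedBall (0 : EuclideanSpace ℝ (Fin 3)) R, ‖W s y‖ ≤ M ∧ ‖fderiv ℝ (W s) y‖ ≤ M)
    (hWs : SliceRegular W s)
    (hV : FunctionSpaces.IsTestFunctionOn (⊤ : Opens (EuclideanSpace ℝ (Fin 3))) V)
    (hZ : FunctionSpaces.IsTestFunctionOn (⊤ : Opens (EuclideanSpace ℝ (Fin 3))) Z)
    (hZ0 : ∀ y, y ∉ closedBall (0 : EuclideanSpace ℝ (Fin 3)) R → Z y = 0 ∧ fderiv ℝ Z y = 0)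
    {Cb : ℝ} (hVb : ∫ y, ‖V y‖ ^ 2 ≤ Cb) {N : ℝ} (hN0 : 0 ≤ N * Cb)
    (hB : ∀ y, ‖(ρ ⋆[ContinuousLinearMap.lsmul ℝ ℝ, volume] V) y‖ ^ 2 ≤ N * Cb)
    {Cℓ : ℝ} (hℓ : |lerayPairing W s Z| ≤ Cℓ) (hlam : 0 < lam) :
    |galerkinForm W ρ s V Z| ≤ 4 * lam * (∫ y, frobeniusNormSq (fderiv ℝ V y)) +
      ((1 / 2 + 1 / 2 * M ^ 2) * Cb + (∫ y, ‖Z y‖ ^ 2) + Cℓ + M ^ 2 * ∫ y, ‖Z y‖) +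
      (4 * lam)⁻¹ * ((∫ y, (frobeniusNormSq (fderiv ℝ Z y) + ‖y‖ ^ 2 * ‖Z y‖ ^ 2 +
        M ^ 2 * ‖Z y‖ ^ 2)) + N * Cb * ∫ y, ‖Z y‖ ^ 2) := by
  have b1 := abs_galerkinLinear_le hM hWs hV hZ hZ0 hlam
  have hBs : ∀ y, ‖(ρ ⋆[ContinuousLinearMap.lsmul ℝ ℝ, volume] V) y‖ ≤ Real.sqrt (N * Cb) :=
    fun y => by
    rw [← abs_of_nonneg (norm_nonneg ((ρ ⋆[ContinuousLinearMap.lsmul ℝ ℝ, volume] V) y))]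
    exact Real.abs_le_sqrt (hB y)
  have b2 := abs_galerkinTrilinear_le (lam := lam) hρ hρc hV hZ hBs hlam
  rw [Real.sq_sqrt hN0] at b2
  have b3 := abs_galerkinSource_le hM0 hM hWs hZ hZ0 hℓ
  have hD0 : 0 ≤ ∫ y, frobeniusNormSq (fderiv ℝ V y) := integral_nonneg fun y => frobeniusNormSq_nonneg _
  have hZ2 : 0 ≤ ∫ y, ‖Z y‖ ^ 2 := integral_nonneg fun y => by positivity
  have hM2 : 0 ≤ 1 / 2 + 1 / 2 * M ^ 2 := by positivity
  have h4 : 0 ≤ (4 * lam)⁻¹ := by positivity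
  have htri : |galerkinForm W ρ s V Z| ≤ |galerkinLinear W s V Z| + |galerkinTrilinear ρ V V Z| +
      |galerkinSource W s Z| := by
    rw [galerkinForm_apply]
    exact abs_add_three _ _ _
  have hE : (1 / 2 + 1 / 2 * M ^ 2) * (∫ y, ‖V y‖ ^ 2) ≤ (1 / 2 + 1 / 2 * M ^ 2) * Cb :=
    mul_le_mul_of_nonneg_left hVb hM2
  nlinarith [htri, b1, b2, b3, hE, mul_nonneg h4 (mul_nonneg (le_trans (by positivity) hN0) hZ2)]

variable {T : ℝ}

/-- **Equicontinuity of the pairings of the Galerkin approximants with a fixed element of the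
Galerkin space — uniformly in the dimension.** Fix `T > 0`, a `C¹` `T`-periodic profile `W`, a
continuous compactly supported kernel `ρ` (`= η_ε`), a test field `g` with
`|⟨LW(s), g⟩| ≤ C_ℓ` for all `s`, and bounds `C_b, C_d ≥ 0`. There are `K₁, K₂ ≥ 0` such that
for **every** finite `L²`-orthonormal family `a` of test fields, every `T`-periodic solution `b`
of the Galerkin system over `a` with `‖b(s)‖² ≤ C_b` (i.e. `∫|U_k(s)|² ≤ C_b`) and
`∫₀ᵀ ∫|∇U_k|² ≤ C_d` (the bounds of Lemma 2.6), and every coefficient vector `c` with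
`Σⱼ cⱼaⱼ = g` (i.e. `g` in the Galerkin space), the pairing `s ↦ (U_k(s), g)` satisfies
`|(U_k(t), g) − (U_k(s), g)| ≤ K₁ (t − s) + K₂ √(t − s)` for `s ≤ t ≤ s + T`: the time
regularity "`∂ₛU_k` bounded in `L^{4/3}(0,T; V')`-type norms" of the Galerkin method (Temam,
Ch. III, §3, (3.46)–(3.48)), here by `(U_k(t), g) − (U_k(s), g) = ∫ₛᵗ RHS` and Young's
inequality with parameter `λ = √(t − s)` on each term of the right-hand side. This is the
equicontinuity input of the Aubin–Lions extraction for `k → ∞`. [cite: Temam1979, Ch. III §3 (3.46)–(3.48); BradshawTsai2017AHP, proof of Thm 2.4 ("through a standard limiting process")] -/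
theorem exists_pairing_modulus (hT : 0 < T) (hW : ContDiff ℝ 1 (uncurry W))
    (hper : ∀ s y, W (s + T) y = W s y) (hρ : Continuous ρ) (hρc : HasCompactSupport ρ)
    {g : EuclideanSpace ℝ (Fin 3) → EuclideanSpace ℝ (Fin 3)}
    (hg : FunctionSpaces.IsTestFunctionOn (⊤ : Opens (EuclideanSpace ℝ (Fin 3))) g)
    {Cℓ : ℝ} (hℓ : ∀ s, |lerayPairing W s g| ≤ Cℓ) {Cb Cd : ℝ} (hCb0 : 0 ≤ Cb) (hCd0 : 0 ≤ Cd) :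
    ∃ K₁ K₂ : ℝ, 0 ≤ K₁ ∧ 0 ≤ K₂ ∧
      ∀ {k : ℕ} {a : Fin k → EuclideanSpace ℝ (Fin 3) → EuclideanSpace ℝ (Fin 3)}
        {b : ℝ → EuclideanSpace ℝ (Fin k)},
        (∀ i, FunctionSpaces.IsTestFunctionOn (⊤ : Opens (EuclideanSpace ℝ (Fin 3))) (a i)) →
        (∀ i j, ∫ y, ⟪a i y, a j y⟫ = if i = j then (1 : ℝ) else 0) →
        (∀ s, HasDerivAt b (galerkinRHS W ρ a s (b s)) s) → (∀ s, b (s + T) = b s) →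
        (∀ s, ‖b s‖ ^ 2 ≤ Cb) →
        (∫ s in (0 : ℝ)..T, (∫ y, frobeniusNormSq (fderiv ℝ (galerkinSum a (b s)) y)) ≤ Cd) →
        ∀ c : EuclideanSpace ℝ (Fin k), galerkinSum a c = g →
        ∀ s t : ℝ, s ≤ t → t ≤ s + T →
          |(∫ y, ⟪galerkinSum a (b t) y, g y⟫) - ∫ y, ⟪galerkinSum a (b s) y, g y⟫| ≤
            K₁ * (t - s) + K₂ * Real.sqrt (t - s) := by
  -- the support of `g` and the bounds of the profile on it
  obtain ⟨R, hR0, hRsub, hg0⟩ := exists_closedBall_of_isTestFunctionOn hg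
  obtain ⟨M, hM0, hMW, hMDW⟩ := exists_profile_bound_of_periodic hT hW hper R
  have hM : ∀ s, ∀ y ∈ closedBall (0 : EuclideanSpace ℝ (Fin 3)) R,
      ‖W s y‖ ≤ M ∧ ‖fderiv ℝ (W s) y‖ ≤ M := fun s y hy => ⟨hMW s y hy, hMDW s y hy⟩
  -- the constants
  set Ig2 : ℝ := ∫ y, ‖g y‖ ^ 2 with hIg2
  set Ig1 : ℝ := ∫ y, ‖g y‖ with hIg1
  set Kg : ℝ := ∫ y, (frobeniusNormSq (fderiv ℝ g y) + ‖y‖ ^ 2 * ‖g y‖ ^ 2 + M ^ 2 * ‖g y‖ ^ 2)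
    with hKg
  set N : ℝ := ∫ t, ρ t ^ 2 with hN
  have hIg2_0 : 0 ≤ Ig2 := integral_nonneg fun y => by positivity
  have hIg1_0 : 0 ≤ Ig1 := integral_nonneg fun y => norm_nonneg _
  have hKg_0 : 0 ≤ Kg := integral_nonneg fun y => by
    have := frobeniusNormSq_nonneg (fderiv ℝ g y); positivity
  have hN_0 : 0 ≤ N := integral_nonneg fun t => by positivity
  have hCℓ0 : 0 ≤ Cℓ := (abs_nonneg _).trans (hℓ 0)
  set P : ℝ := (1 / 2 + 1 / 2 * M ^ 2) * Cb + Ig2 + Cℓ + M ^ 2 * Ig1 with hP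
  set Q : ℝ := Kg + N * Cb * Ig2 with hQ
  have hP0 : 0 ≤ P := by positivity
  have hQ0 : 0 ≤ Q := by positivity
  refine ⟨P, 4 * Cd + Q / 4, hP0, by positivity, ?_⟩
  intro k a b ha hon hb hbT hCb hCd c hcg s t hst htT
  -- the solution is continuous and stays in the ball of radius `√C_b`
  have hbc : Continuous b := continuous_iff_continuousAt.2 fun σ => (hb σ).continuousAt
  have hbR : ∀ σ, b σ ∈ closedBall (0 : EuclideanSpace ℝ (Fin k)) (Real.sqrt Cb) := fun σ => by
    rw [mem_closedBall, dist_zero_right, ← Real.sqrt_sq (norm_nonneg (b σ))]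
    exact Real.sqrt_le_sqrt (hCb σ)
  have hac : ∀ i, Continuous (a i) := fun i => (ha i).contDiff.continuous
  have has : ∀ i, HasCompactSupport (a i) := fun i => (ha i).hasCompactSupport
  -- notation: the approximants, the dissipation, the right-hand side along the solution
  set U : ℝ → EuclideanSpace ℝ (Fin 3) → EuclideanSpace ℝ (Fin 3) := fun σ => galerkinSum a (b σ)
    with hU
  set D : ℝ → ℝ := fun σ => ∫ y, frobeniusNormSq (fderiv ℝ (U σ) y) with hD
  set F : ℝ → ℝ := fun σ => galerkinForm W ρ σ (U σ) g with hF
  have hUtest : ∀ σ, FunctionSpaces.IsTestFunctionOn (⊤ : Opens (EuclideanSpace ℝ (Fin 3))) (U σ) :=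
    fun σ => isTestFunctionOn_galerkinSum ha (b σ)
  have hUE : ∀ σ, ∫ y, ‖U σ y‖ ^ 2 ≤ Cb := fun σ => by
    rw [hU, integral_norm_sq_galerkinSum hac has hon (b σ)]
    exact hCb σ
  have hD0 : ∀ σ, 0 ≤ D σ := fun σ => integral_nonneg fun y => frobeniusNormSq_nonneg _
  have hDc : Continuous D := continuous_dissipation_galerkinSum ha hbc
  have hDper : Function.Periodic D T := fun σ => by
    simp only [hD, hU, hbT σ]
  have hFc : Continuous F := by
    have h := continuous_galerkinForm_along hT hW hper hρ hρc ha hb hbR c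
    rw [hcg] at h
    exact h
  -- the sup bound of the mollified ansatz
  have hconv : ∀ σ y, ‖(ρ ⋆[ContinuousLinearMap.lsmul ℝ ℝ, volume] U σ) y‖ ^ 2 ≤ N * Cb :=
    fun σ y => (norm_sq_convolution_le hρ hρc (hUtest σ).contDiff.continuous
      (hUtest σ).hasCompactSupport y).trans (mul_le_mul_of_nonneg_left (hUE σ) hN_0)
  -- the bound of the right-hand side along the solution, for every `λ > 0`
  have hFle : ∀ {lam : ℝ}, 0 < lam → ∀ σ, |F σ| ≤ 4 * lam * D σ + P + (4 * lam)⁻¹ * Q := by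
    intro lam hlam σ
    have h := abs_galerkinForm_le (lam := lam) hρ hρc hM0 (hM σ) (SliceRegular.of_contDiff hW σ)
      (hUtest σ) hg hg0 (hUE σ) (N := N) (by positivity) (hconv σ) (hℓ σ) hlam
    simpa only [hF, hD, hP, hQ, hIg2, hIg1, hKg] using h
  -- the difference of the pairings is the integral of the right-hand side
  have hdiff : (∫ y, ⟪galerkinSum a (b t) y, g y⟫) - ∫ y, ⟪galerkinSum a (b s) y, g y⟫ =
      ∫ σ in s..t, F σ := by
    have h := integral_galerkinForm_eq_pairing_sub hT hW hper hρ hρc ha hon hb hbR c s t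
    rw [hcg] at h
    exact h.symm
  -- the dissipation over `[s, t]` is at most one period's worth
  have hDint : ∫ σ in s..t, D σ ≤ Cd := by
    calc ∫ σ in s..t, D σ ≤ ∫ σ in s..s + T, D σ :=
          intervalIntegral.integral_mono_interval le_rfl hst htT
            (Eventually.of_forall fun σ => hD0 σ) (hDc.intervalIntegrable _ _)
      _ = ∫ σ in (0 : ℝ)..0 + T, D σ := hDper.intervalIntegral_add_eq s 0
      _ = ∫ σ in (0 : ℝ)..T, D σ := by rw [zero_add]
      _ ≤ Cd := hCd
  rw [hdiff]
  rcases eq_or_lt_of_le hst with heq | hlt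
  · subst heq
    simp only [intervalIntegral.integral_same, abs_zero, sub_self, Real.sqrt_zero, mul_zero, add_zero]
    exact le_refl _
  · -- `λ = √(t - s)`
    set r : ℝ := Real.sqrt (t - s) with hr
    have hts : 0 < t - s := sub_pos.2 hlt
    have hr0 : 0 < r := Real.sqrt_pos.2 hts
    have hr2 : r ^ 2 = t - s := Real.sq_sqrt hts.le
    have hbound : ∀ σ ∈ Icc s t, |F σ| ≤ 4 * r * D σ + (P + (4 * r)⁻¹ * Q) := fun σ _ => by
      have := hFle hr0 σ; linarith
    calc |∫ σ in s..t, F σ| ≤ ∫ σ in s..t, |F σ| :=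
          intervalIntegral.abs_integral_le_integral_abs hst
      _ ≤ ∫ σ in s..t, (4 * r * D σ + (P + (4 * r)⁻¹ * Q)) :=
          intervalIntegral.integral_mono_on hst (hFc.abs.intervalIntegrable _ _)
            (((continuous_const.mul hDc).add continuous_const).intervalIntegrable _ _) hbound
      _ = 4 * r * (∫ σ in s..t, D σ) + (t - s) * (P + (4 * r)⁻¹ * Q) := by
          have i1 : IntervalIntegrable (fun σ => 4 * r * D σ) volume s t :=
            (continuous_const.mul hDc).intervalIntegrable _ _
          have i2 : IntervalIntegrable (fun _ : ℝ => P + (4 * r)⁻¹ * Q) volume s t :=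
            intervalIntegrable_const
          rw [intervalIntegral.integral_add i1 i2, intervalIntegral.integral_const_mul,
            intervalIntegral.integral_const, smul_eq_mul]
      _ ≤ 4 * r * Cd + (t - s) * (P + (4 * r)⁻¹ * Q) := by
          gcongr
      _ = P * (t - s) + (4 * Cd + Q / 4) * r := by
          rw [← hr2]
          field_simp
          ring

end Modulus

end BradshawTsai2017

end Literature.Analysis.FluidPDE

end
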